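import Mathlib.Analysis.Fourier.AddCircleMulti
import Mathlib.Topology.UniformSpace.HeineCantor
import Mathlib.Algebra.Order.Archimedean.Basic
import Mathlib.Topology.Order.ProjIcc
import Literature.NumberTheory.DiophantineApproximation.KroneckerWeyl
import HarnessLib

/-!
# Uniform distribution modulo one in `ℝ^s`; Weyl's criterion on the torus

Topic `Literature/NumberTheory/UniformDistribution` (definition request `defn-EquidistributedModOne`,
multidimensional part, wanted by `route-Schanuel-BenfordTowers`). Everything here is PROVED.

Source: L. Kuipers, H. Niederreiter, *Uniform distribution of sequences* (Wiley 1974), Ch. 1 §6,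
pp. 47–48 [KuipersNiederreiter1974]. For a sequence `x : ℕ → (ι → ℝ)` of vectors (`ι` a finite
index type, K–N: `ℝ^s`) and a box `[a, b) = Π_i [a_i, b_i) ⊆ [0,1)^ι` let
`A([a,b); N) = #{n < N : {x n} ∈ [a, b)}` (`fractCountPi`; fractional parts coordinatewise).

* `EquidistributedModOnePi x` — **Definition 6.1**: `x` is u.d. mod 1 in `ℝ^ι` if
  `A([a,b); N)/N → Π_i (b_i - a_i)` for all boxes with `0 ≤ a_i < b_i ≤ 1`.
* `equidistributedModOnePi_iff_weyl` — **Theorem 6.2 (Weyl criterion)**: `x` is u.d. mod 1 in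
  `ℝ^ι` iff for every lattice point `h : ι → ℤ`, `h ≠ 0`,
  `Σ_{n<N} e(⟨h, x n⟩) = o(N)`, the Weyl sums written
  `∑ n ∈ Finset.range N, Complex.exp (2 * Real.pi * Complex.I * ((∑ i, (h i : ℝ) * x n i : ℝ) : ℂ))`.
* `EquidistributedModOnePi.tendsto_avg_continuousMap` — the periodic form of **Theorem 6.1**: for
  every continuous `F` on the torus `(ℝ/ℤ)^ι` (Mathlib's `UnitAddTorus ι`),
  `(1/N) Σ_{n<N} F(x n mod 1) → ∫ F dθ` (Haar probability measure); real-valued version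
  `EquidistributedModOnePi.tendsto_fractAvgPi_continuousMap`, and the sandwich form for Riemann-
  integrable test functions `EquidistributedModOnePi.tendsto_fractAvgPi_of_sandwich`.
* `EquidistributedModOnePi.tendsto_fractAvgPi_of_riemannSum` — the mechanism of Theorem 6.1 on
  the cube: if `g` is continuous on `[0,1]^ι` and its Riemann sums over the uniform `K`-grids tend
  to `L`, then `(1/N) Σ_{n<N} g({x n}) → L`.

## Proofs

(Def. 6.1 ⇒ Weyl) K–N's step-function argument for Theorem 6.1: a character `e(⟨h, ·⟩)` is
uniformly continuous on the cube, so it is uniformly approximated on `[0,1)^ι` by its values on the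
`K`-grid; the grid cells are boxes, and the Riemann sum of a nontrivial character over the `K`-grid
vanishes exactly once `K > Σ|h_i|` (a geometric sum of `K`-th roots of unity in one coordinate).
(Weyl ⇒ continuous `F` on the torus) the characters `UnitAddTorus.mFourier h` span a dense
subspace of `C((ℝ/ℤ)^ι, ℂ)` (Mathlib's Stone–Weierstrass `UnitAddTorus.span_mFourier_closure_eq_top`)
and the set of good `F` is a closed subspace (the averaging functionals are `1`-Lipschitz), as in
the tree's `Literature.NumberTheory.DiophantineApproximation.KroneckerWeyl`.
(continuous `F` ⇒ boxes) squeeze the indicator of a box between products of the continuous circle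
functions `clamp((r ± δ - ‖z - m‖)/δ)` (`clamp` = `Set.projIcc 0 1`, `m` = midpoint, `r` = half-length of
`[a_i, b_i)`), whose
Haar integrals are within `2δ` of `b_i - a_i` (`integral_arcUpper_le`, `le_integral_arcLower`).

Theorem 6.3 (reduction to `⟨h, x n⟩` u.d. mod 1) and Example 6.1 (Kronecker–Weyl: `(nθ)` for
`1, θ_1, …, θ_s` linearly independent over `ℚ`) are in the sibling file `KroneckerSequence.lean`,
which also links this notion with the one-dimensional `EquidistributedModOne`.
Theorem 6.1 for continuous functions on the CLOSED cube `[0,1]^ι` with limit `∫_{[0,1]^ι} g`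
(identification of the limit of the Riemann sums with the Lebesgue integral) is in the sibling file
`CubeTestFunctions.lean`; here `tendsto_fractAvgPi_of_riemannSum` isolates exactly that step.

## References

* [KuipersNiederreiter1974] L. Kuipers, H. Niederreiter, *Uniform distribution of sequences*, Wiley
  1974, Ch. 1 §6: Def. 6.1 (p. 47), Thms. 6.1–6.3, Example 6.1 (p. 48).
* [Weyl1916] H. Weyl, *Über die Gleichverteilung von Zahlen mod. Eins*, Math. Ann. 77 (1916) 313–352.
-/

noncomputable section

open Filter Topology Asymptotics MeasureTheory Set

namespace Literature.NumberTheory.UniformDistribution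

open Literature.NumberTheory.DiophantineApproximation (KroneckerWeyl.integral_mFourier
  KroneckerWeyl.integrable_continuousMap KroneckerWeyl.lipschitzWith_integral
  KroneckerWeyl.isProbabilityMeasure_volume_unitAddTorus KroneckerWeyl.integrable_of_continuous)

variable {ι : Type*} [Fintype ι]

/-! ### Definition 6.1 -/

/-- The counting function `A([a,b); N)` in `ℝ^ι`: the number of indices `n < N` for which the
vector of fractional parts `({x n i})_i` lies in the box `Π_i [a_i, b_i)`.
[cite: KuipersNiederreiter1974, Ch. 1 §6, p. 47] -/
def fractCountPi (x : ℕ → ι → ℝ) (a b : ι → ℝ) (N : ℕ) : ℕ :=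
  ((Finset.range N).filter fun n => ∀ i, Int.fract (x n i) ∈ Set.Ico (a i) (b i)).card

/-- **Uniform distribution modulo 1 in `ℝ^ι`** (K–N Definition 6.1): a sequence `x` of vectors is
u.d. mod 1 if for every box `[a, b) ⊆ [0,1)^ι` (`0 ≤ a_i < b_i ≤ 1`) the proportion of indices
`n < N` with `{x n} ∈ [a, b)` tends to the volume `Π_i (b_i - a_i)`.
[cite: KuipersNiederreiter1974, Ch. 1, Definition 6.1] -/
def EquidistributedModOnePi (x : ℕ → ι → ℝ) : Prop :=
  ∀ ⦃a b : ι → ℝ⦄, (∀ i, 0 ≤ a i) → (∀ i, a i < b i) → (∀ i, b i ≤ 1) →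
    Tendsto (fun N : ℕ => (fractCountPi x a b N : ℝ) / N) atTop (𝓝 (∏ i, (b i - a i)))

/-- The **Weyl sum** `Σ_{n<N} e(⟨h, x n⟩)` at the lattice point `h : ι → ℤ`.
[cite: KuipersNiederreiter1974, Ch. 1, Theorem 6.2] -/
def weylSumPi (x : ℕ → ι → ℝ) (h : ι → ℤ) (N : ℕ) : ℂ :=
  ∑ n ∈ Finset.range N, Complex.exp (2 * Real.pi * Complex.I * ((∑ i, (h i : ℝ) * x n i : ℝ) : ℂ))

variable {x : ℕ → ι → ℝ}

/-- `A([a,b); N) ≤ N`. [folklore] -/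
theorem fractCountPi_le (x : ℕ → ι → ℝ) (a b : ι → ℝ) (N : ℕ) : fractCountPi x a b N ≤ N :=
  (Finset.card_filter_le _ _).trans (Finset.card_range N).le

/-- Unfolding lemma for `EquidistributedModOnePi`. [cite: KuipersNiederreiter1974, Ch. 1, Definition 6.1] -/
theorem equidistributedModOnePi_iff (x : ℕ → ι → ℝ) :
    EquidistributedModOnePi x ↔ ∀ ⦃a b : ι → ℝ⦄, (∀ i, 0 ≤ a i) → (∀ i, a i < b i) →
      (∀ i, b i ≤ 1) →
      Tendsto (fun N : ℕ => (fractCountPi x a b N : ℝ) / N) atTop (𝓝 (∏ i, (b i - a i))) :=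
  Iff.rfl

/-! ### Averages of real test functions of the fractional parts; the squeeze lemma -/

/-- The averaging functional `g ↦ (1/N) Σ_{n<N} g({x n})` on real test functions of `ℝ^ι`
(`{y} = (Int.fract y_i)_i`). [folklore] -/
def fractAvgPi (x : ℕ → ι → ℝ) (N : ℕ) (g : (ι → ℝ) → ℝ) : ℝ :=
  (∑ n ∈ Finset.range N, g (fun i => Int.fract (x n i))) / N

omit [Fintype ι] in
/-- The vector of fractional parts lies in the half-open unit cube. [folklore] -/
theorem fract_mem_cube (y : ι → ℝ) :
    (fun i => Int.fract (y i)) ∈ Set.pi Set.univ fun _ : ι => Set.Ico (0 : ℝ) 1 :=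
  fun i _ => ⟨Int.fract_nonneg (y i), Int.fract_lt_one (y i)⟩

omit [Fintype ι] in
/-- Monotonicity of the average (only values on `[0,1)^ι` matter). [folklore] -/
theorem fractAvgPi_mono (x : ℕ → ι → ℝ) (N : ℕ) {g₁ g₂ : (ι → ℝ) → ℝ}
    (h : ∀ y ∈ Set.pi Set.univ fun _ : ι => Set.Ico (0 : ℝ) 1, g₁ y ≤ g₂ y) :
    fractAvgPi x N g₁ ≤ fractAvgPi x N g₂ :=
  div_le_div_of_nonneg_right (Finset.sum_le_sum fun n _ => h _ (fract_mem_cube (x n)))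
    (Nat.cast_nonneg N)

omit [Fintype ι] in
/-- Additivity of the average. [folklore] -/
theorem fractAvgPi_add (x : ℕ → ι → ℝ) (N : ℕ) (g₁ g₂ : (ι → ℝ) → ℝ) :
    fractAvgPi x N (fun y => g₁ y + g₂ y) = fractAvgPi x N g₁ + fractAvgPi x N g₂ := by
  simp [fractAvgPi, Finset.sum_add_distrib, add_div]

omit [Fintype ι] in
/-- The average of a difference. [folklore] -/
theorem fractAvgPi_sub (x : ℕ → ι → ℝ) (N : ℕ) (g₁ g₂ : (ι → ℝ) → ℝ) :
    fractAvgPi x N (fun y => g₁ y - g₂ y) = fractAvgPi x N g₁ - fractAvgPi x N g₂ := by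
  simp [fractAvgPi, Finset.sum_sub_distrib, sub_div]

omit [Fintype ι] in
/-- Homogeneity of the average. [folklore] -/
theorem fractAvgPi_const_mul (x : ℕ → ι → ℝ) (N : ℕ) (c : ℝ) (g : (ι → ℝ) → ℝ) :
    fractAvgPi x N (fun y => c * g y) = c * fractAvgPi x N g := by
  simp [fractAvgPi, ← Finset.mul_sum, mul_div_assoc]

omit [Fintype ι] in
/-- The average of a finite sum of test functions. [folklore] -/
theorem fractAvgPi_finset_sum (x : ℕ → ι → ℝ) (N : ℕ) {κ : Type*} (s : Finset κ)
    (g : κ → (ι → ℝ) → ℝ) :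
    fractAvgPi x N (fun y => ∑ k ∈ s, g k y) = ∑ k ∈ s, fractAvgPi x N (g k) := by
  simp only [fractAvgPi]
  rw [Finset.sum_comm, Finset.sum_div]

omit [Fintype ι] in
/-- The average of a constant (for `N ≠ 0`). [folklore] -/
theorem fractAvgPi_const (x : ℕ → ι → ℝ) {N : ℕ} (hN : N ≠ 0) (c : ℝ) :
    fractAvgPi x N (fun _ => c) = c := by
  have : (N : ℝ) ≠ 0 := Nat.cast_ne_zero.2 hN
  simp [fractAvgPi, this]

/-- The average of the indicator of a box is the counting frequency. [folklore] -/
theorem fractAvgPi_indicator (x : ℕ → ι → ℝ) (N : ℕ) (a b : ι → ℝ) :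
    fractAvgPi x N (Set.indicator (Set.pi Set.univ fun i => Set.Ico (a i) (b i)) 1) =
      (fractCountPi x a b N : ℝ) / N := by
  unfold fractAvgPi fractCountPi
  rw [Finset.natCast_card_filter]
  congr 1
  refine Finset.sum_congr rfl fun n _ => ?_
  by_cases h : ∀ i, Int.fract (x n i) ∈ Set.Ico (a i) (b i)
  · rw [if_pos h, Set.indicator_of_mem (show (fun i => Int.fract (x n i)) ∈
        Set.pi Set.univ (fun i => Set.Ico (a i) (b i)) from fun i _ => h i), Pi.one_apply]
  · rw [if_neg h, Set.indicator_of_notMem]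
    exact fun hmem => h fun i => hmem i (Set.mem_univ i)

omit [Fintype ι] in
/-- **Squeeze lemma**: if for every `ε > 0` the test function `f` is squeezed on `[0,1)^ι` between
test functions whose averages converge to limits within `ε` of `L`, the averages of `f` converge to
`L`. [folklore] -/
theorem tendsto_fractAvgPi_squeeze (x : ℕ → ι → ℝ) {f : (ι → ℝ) → ℝ} {L : ℝ}
    (h : ∀ ε > 0, ∃ (g₁ g₂ : (ι → ℝ) → ℝ) (L₁ L₂ : ℝ),
      (∀ y ∈ Set.pi Set.univ fun _ : ι => Set.Ico (0 : ℝ) 1, g₁ y ≤ f y) ∧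
      (∀ y ∈ Set.pi Set.univ fun _ : ι => Set.Ico (0 : ℝ) 1, f y ≤ g₂ y) ∧
      Tendsto (fun N => fractAvgPi x N g₁) atTop (𝓝 L₁) ∧
      Tendsto (fun N => fractAvgPi x N g₂) atTop (𝓝 L₂) ∧ L - ε ≤ L₁ ∧ L₂ ≤ L + ε) :
    Tendsto (fun N => fractAvgPi x N f) atTop (𝓝 L) := by
  refine tendsto_order.2 ⟨fun c hc => ?_, fun c hc => ?_⟩
  · obtain ⟨g₁, g₂, L₁, L₂, hg₁, -, h₁, -, hL₁, -⟩ := h ((L - c) / 2) (by linarith)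
    have hc' : c < L₁ := by linarith
    filter_upwards [(tendsto_order.1 h₁).1 c hc'] with N hN
    exact hN.trans_le (fractAvgPi_mono x N hg₁)
  · obtain ⟨g₁, g₂, L₁, L₂, -, hg₂, -, h₂, -, hL₂⟩ := h ((c - L) / 2) (by linarith)
    have hc' : L₂ < c := by linarith
    filter_upwards [(tendsto_order.1 h₂).2 c hc'] with N hN
    exact (fractAvgPi_mono x N hg₂).trans_lt hN

/-! ### From Definition 6.1 to Riemann sums over the uniform grids -/

/-- **From boxes to Riemann sums** (the mechanism of K–N Theorem 6.1): let `x` be u.d. mod 1 in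
`ℝ^ι` and `g` real-valued, continuous on the closed cube `[0,1]^ι`. If the Riemann sums
`K^{-#ι} Σ_{j ∈ {0,…,K-1}^ι} g(j/K)` are eventually within every `ε` of `L`, then
`(1/N) Σ_{n<N} g({x n}) → L`. [cite: KuipersNiederreiter1974, Ch. 1, Theorem 6.1] -/
theorem EquidistributedModOnePi.tendsto_fractAvgPi_of_riemannSum [DecidableEq ι]
    (hx : EquidistributedModOnePi x)
    {g : (ι → ℝ) → ℝ} (hg : ContinuousOn g (Set.Icc 0 1)) {L : ℝ}
    (hL : ∀ ε > 0, ∀ᶠ K : ℕ in atTop,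
      |(∑ j ∈ Fintype.piFinset fun _ : ι => Finset.range K, g (fun i => (j i : ℝ) / K)) /
        (K : ℝ) ^ Fintype.card ι - L| ≤ ε) :
    Tendsto (fun N => fractAvgPi x N g) atTop (𝓝 L) := by
  refine tendsto_fractAvgPi_squeeze x fun ε hε => ?_
  have hε2 : 0 < ε / 2 := half_pos hε
  -- uniform continuity of `g` on the compact cube
  obtain ⟨δ, hδ, hUC⟩ := Metric.uniformContinuousOn_iff_le.1
    (isCompact_Icc.uniformContinuousOn_of_continuous hg) (ε / 2) hε2
  obtain ⟨K₀, hK₀⟩ := exists_nat_one_div_lt hδ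
  obtain ⟨K, hKK₀, hKL⟩ := ((eventually_ge_atTop (K₀ + 1)).and (hL (ε / 2) hε2)).exists
  have hK : 0 < K := by omega
  have hKr : (0 : ℝ) < K := Nat.cast_pos.2 hK
  have hKδ : 1 / (K : ℝ) ≤ δ := by
    refine le_trans ?_ hK₀.le
    gcongr
    exact_mod_cast hKK₀
  -- the grid, the cells, the step function
  set J : Finset (ι → ℕ) := Fintype.piFinset fun _ : ι => Finset.range K with hJ
  set c : (ι → ℕ) → ℝ := fun j => g (fun i => (j i : ℝ) / K) with hc
  set cell : (ι → ℕ) → Set (ι → ℝ) := fun j =>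
    Set.pi Set.univ fun i => Set.Ico ((j i : ℝ) / K) ((j i + 1) / K) with hcell
  set step : (ι → ℝ) → ℝ := fun y => ∑ j ∈ J, c j * Set.indicator (cell j) 1 y with hstep
  -- on `[0,1)^ι` the step function is `g(⌊Ky⌋/K)`, within `ε/2` of `g y`
  have hmem_cell : ∀ y ∈ Set.pi Set.univ (fun _ : ι => Set.Ico (0 : ℝ) 1), ∀ j : ι → ℕ,
      y ∈ cell j ↔ (fun i => ⌊(K : ℝ) * y i⌋₊) = j := by
    intro y hy j
    simp only [hcell, Set.mem_pi, Set.mem_univ, true_imp_iff, funext_iff]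
    refine forall_congr' fun i => ?_
    -- the grid cell `[j/K, (j+1)/K)` containing `t ≥ 0` is the one with `j = ⌊Kt⌋`
    rw [Nat.floor_eq_iff (mul_nonneg hKr.le (hy i (Set.mem_univ i)).1), Set.mem_Ico,
      div_le_iff₀ hKr, lt_div_iff₀ hKr, mul_comm (y i)]
  have hfloor_mem : ∀ y ∈ Set.pi Set.univ (fun _ : ι => Set.Ico (0 : ℝ) 1),
      (fun i => ⌊(K : ℝ) * y i⌋₊) ∈ J := by
    intro y hy
    simp only [hJ, Fintype.mem_piFinset, Finset.mem_range]
    intro i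
    rw [Nat.floor_lt (mul_nonneg hKr.le (hy i (Set.mem_univ i)).1)]
    calc (K : ℝ) * y i < K * 1 := mul_lt_mul_of_pos_left (hy i (Set.mem_univ i)).2 hKr
      _ = K := mul_one _
  have hstep_eq : ∀ y ∈ Set.pi Set.univ (fun _ : ι => Set.Ico (0 : ℝ) 1),
      step y = c (fun i => ⌊(K : ℝ) * y i⌋₊) := by
    intro y hy
    rw [hstep]
    dsimp only
    rw [Finset.sum_eq_single_of_mem _ (hfloor_mem y hy)]
    · rw [Set.indicator_of_mem ((hmem_cell y hy _).2 rfl), Pi.one_apply, mul_one]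
    · intro j _ hne
      rw [Set.indicator_of_notMem, mul_zero]
      exact fun hmem => hne ((hmem_cell y hy _).1 hmem).symm
  have hclose : ∀ y ∈ Set.pi Set.univ (fun _ : ι => Set.Ico (0 : ℝ) 1), |g y - step y| ≤ ε / 2 := by
    intro y hy
    rw [hstep_eq y hy, hc]
    dsimp only
    have hyI : y ∈ Set.Icc (0 : ι → ℝ) 1 :=
      ⟨fun i => (hy i (Set.mem_univ i)).1, fun i => (hy i (Set.mem_univ i)).2.le⟩
    have h1 : ∀ i, ((⌊(K : ℝ) * y i⌋₊ : ℝ)) / K ≤ y i := fun i => by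
      rw [div_le_iff₀ hKr, mul_comm (y i)]
      exact Nat.floor_le (mul_nonneg hKr.le (hy i (Set.mem_univ i)).1)
    have h2 : ∀ i, y i < ((⌊(K : ℝ) * y i⌋₊ : ℝ) + 1) / K := fun i => by
      rw [lt_div_iff₀ hKr, mul_comm (y i)]
      exact Nat.lt_floor_add_one _
    have hzI : (fun i => ((⌊(K : ℝ) * y i⌋₊ : ℝ)) / K) ∈ Set.Icc (0 : ι → ℝ) 1 :=
      ⟨fun i => by positivity, fun i => (h1 i).trans (hy i (Set.mem_univ i)).2.le⟩
    have hdist : dist y (fun i => ((⌊(K : ℝ) * y i⌋₊ : ℝ)) / K) ≤ δ := by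
      refine (dist_pi_le_iff hδ.le).2 fun i => ?_
      rw [Real.dist_eq, abs_of_nonneg (by linarith [h1 i])]
      have : ((⌊(K : ℝ) * y i⌋₊ : ℝ) + 1) / K = (⌊(K : ℝ) * y i⌋₊ : ℝ) / K + 1 / K := by ring
      linarith [h2 i]
    have := hUC y hyI _ hzI hdist
    rwa [Real.dist_eq] at this
  -- the averages of the step function converge to the Riemann sum `S`
  set S : ℝ := ∑ j ∈ J, c j * (1 / (K : ℝ) ^ Fintype.card ι) with hS
  have havg : Tendsto (fun N => fractAvgPi x N step) atTop (𝓝 S) := by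
    have hrw : ∀ N, fractAvgPi x N step = ∑ j ∈ J, c j *
        ((fractCountPi x (fun i => (j i : ℝ) / K) (fun i => ((j i : ℝ) + 1) / K) N : ℝ) / N) := by
      intro N
      rw [hstep, fractAvgPi_finset_sum]
      refine Finset.sum_congr rfl fun j _ => ?_
      rw [fractAvgPi_const_mul, hcell]
      dsimp only
      rw [fractAvgPi_indicator]
    simp_rw [hrw]
    refine tendsto_finsetSum _ fun j hj => Tendsto.const_mul (c j) ?_
    have hjK : ∀ i, j i + 1 ≤ K := fun i => by
      have := (Fintype.mem_piFinset.1 hj) i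
      exact Finset.mem_range.1 this
    have h := hx (a := fun i => (j i : ℝ) / K) (b := fun i => ((j i : ℝ) + 1) / K)
      (fun i => by positivity) (fun i => div_lt_div_of_pos_right (lt_add_one _) hKr)
      (fun i => (div_le_one hKr).2 (by exact_mod_cast hjK i))
    have hprod : ∏ i : ι, (((j i : ℝ) + 1) / K - (j i : ℝ) / K) = 1 / (K : ℝ) ^ Fintype.card ι := by
      rw [Finset.prod_congr rfl fun i _ => show ((j i : ℝ) + 1) / K - (j i : ℝ) / K = 1 / K by ring,
        Finset.prod_const, Finset.card_univ, one_div_pow]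
    rwa [hprod] at h
  -- `|S - L| ≤ ε/2` by the choice of `K`
  have hSL : |S - L| ≤ ε / 2 := by
    have : S = (∑ j ∈ J, c j) / (K : ℝ) ^ Fintype.card ι := by
      rw [hS, ← Finset.sum_mul, mul_one_div]
    rw [this]
    exact hKL
  -- the squeeze
  refine ⟨fun y => step y - ε / 2, fun y => step y + ε / 2, S - ε / 2, S + ε / 2,
    fun y hy => ?_, fun y hy => ?_, ?_, ?_, ?_, ?_⟩
  · have := hclose y hy; rw [abs_le] at this; linarith
  · have := hclose y hy; rw [abs_le] at this; linarith
  · refine (havg.sub_const (ε / 2)).congr' ?_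
    filter_upwards [eventually_ne_atTop 0] with N hN
    rw [fractAvgPi_sub, fractAvgPi_const x hN]
  · refine (havg.add_const (ε / 2)).congr' ?_
    filter_upwards [eventually_ne_atTop 0] with N hN
    rw [fractAvgPi_add, fractAvgPi_const x hN]
  · rw [abs_le] at hSL; linarith
  · rw [abs_le] at hSL; linarith

/-! ### From Definition 6.1 to Weyl's criterion -/

/-- `e(t) = 1` forces `t ∈ ℤ`; concretely, `e(h/K) ≠ 1` for `0 < |h| < K`. [folklore] -/
theorem exp_two_pi_mul_div_ne_one {h : ℤ} {K : ℕ} (hh : h ≠ 0) (hK : h.natAbs < K) :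
    Complex.exp (2 * Real.pi * Complex.I * (((h : ℝ) / K : ℝ) : ℂ)) ≠ 1 := by
  intro h1
  obtain ⟨m, hm⟩ := Complex.exp_eq_one_iff.1 h1
  have hK0 : (K : ℝ) ≠ 0 := by
    have : 0 < K := lt_of_le_of_lt (Nat.zero_le _) hK
    exact_mod_cast this.ne'
  have h2πI : (2 * Real.pi * Complex.I : ℂ) ≠ 0 := by
    refine mul_ne_zero (mul_ne_zero two_ne_zero ?_) Complex.I_ne_zero
    exact_mod_cast Real.pi_ne_zero
  have h2 : (((h : ℝ) / K : ℝ) : ℂ) = (m : ℂ) := by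
    have : (2 * Real.pi * Complex.I) * (((h : ℝ) / K : ℝ) : ℂ) = (2 * Real.pi * Complex.I) * (m : ℂ) := by
      rw [hm]; ring
    exact mul_left_cancel₀ h2πI this
  have h3 : (h : ℝ) / K = m := by exact_mod_cast h2
  rw [div_eq_iff hK0] at h3
  have h4 : h = m * K := by exact_mod_cast h3
  rcases eq_or_ne m 0 with rfl | hm0
  · simp at h4; exact hh h4
  · have : K ≤ h.natAbs := by
      rw [h4, Int.natAbs_mul, Int.natAbs_natCast]
      exact Nat.le_mul_of_pos_left K (Int.natAbs_pos.2 hm0)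
    omega

/-- **Riemann sums of a nontrivial character over the `K`-grid vanish**: for `h : ι → ℤ`, `h ≠ 0`,
and `K > Σ_i |h_i|`, `Σ_{j ∈ {0,…,K-1}^ι} e(⟨h, j/K⟩) = 0` (in the coordinate `i₀` with `h_{i₀} ≠ 0`
the sum is a full geometric sum of `K`-th roots of unity with ratio `≠ 1`). [folklore] -/
theorem sum_piFinset_exp_eq_zero [DecidableEq ι] {h : ι → ℤ} (hh : h ≠ 0) {K : ℕ}
    (hK : ∑ i, (h i).natAbs < K) :
    ∑ j ∈ Fintype.piFinset (fun _ : ι => Finset.range K),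
      Complex.exp (2 * Real.pi * Complex.I * ((∑ i, (h i : ℝ) * ((j i : ℝ) / K) : ℝ) : ℂ)) = 0 := by
  -- factor the character over the coordinates
  have hfac : ∀ j : ι → ℕ,
      Complex.exp (2 * Real.pi * Complex.I * ((∑ i, (h i : ℝ) * ((j i : ℝ) / K) : ℝ) : ℂ)) =
        ∏ i, Complex.exp (2 * Real.pi * Complex.I * (((h i : ℝ) / K : ℝ) : ℂ)) ^ (j i) := by
    intro j
    push_cast
    rw [Finset.mul_sum, Complex.exp_sum]
    refine Finset.prod_congr rfl fun i _ => ?_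
    rw [← Complex.exp_nat_mul]
    congr 1
    ring
  simp_rw [hfac]
  rw [← Finset.prod_univ_sum]
  obtain ⟨i₀, hi₀⟩ := Function.ne_iff.1 hh
  refine Finset.prod_eq_zero (Finset.mem_univ i₀) ?_
  have hKi : (h i₀).natAbs < K :=
    lt_of_le_of_lt (Finset.single_le_sum (f := fun i => (h i).natAbs) (fun i _ => Nat.zero_le _)
      (Finset.mem_univ i₀)) hK
  set q : ℂ := Complex.exp (2 * Real.pi * Complex.I * (((h i₀ : ℝ) / K : ℝ) : ℂ)) with hq
  have hq1 : q ≠ 1 := exp_two_pi_mul_div_ne_one hi₀ hKi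
  rw [geom_sum_eq hq1]
  have hqK : q ^ K = 1 := by
    rw [hq, ← Complex.exp_nat_mul]
    have hK0 : (K : ℂ) ≠ 0 := by
      have : 0 < K := lt_of_le_of_lt (Nat.zero_le _) hK
      exact_mod_cast this.ne'
    have : (K : ℂ) * (2 * Real.pi * Complex.I * (((h i₀ : ℝ) / K : ℝ) : ℂ)) =
        (h i₀ : ℂ) * (2 * Real.pi * Complex.I) := by
      push_cast
      field_simp
    rw [this]
    exact Complex.exp_int_mul_two_pi_mul_I _
  rw [hqK, sub_self, zero_div]

/-- `e(⟨h, y⟩)` only depends on `y` modulo `ℤ^ι`: `e(⟨h, y⟩) = e(⟨h, {y}⟩)`. [folklore] -/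
theorem exp_two_pi_mul_sum_eq_fract (h : ι → ℤ) (y : ι → ℝ) :
    Complex.exp (2 * Real.pi * Complex.I * ((∑ i, (h i : ℝ) * y i : ℝ) : ℂ)) =
      Complex.exp (2 * Real.pi * Complex.I * ((∑ i, (h i : ℝ) * Int.fract (y i) : ℝ) : ℂ)) := by
  have hy : ∑ i, (h i : ℝ) * y i = ∑ i, (h i : ℝ) * Int.fract (y i) + ((∑ i, h i * ⌊y i⌋ : ℤ) : ℝ) := by
    push_cast
    rw [← Finset.sum_add_distrib]
    refine Finset.sum_congr rfl fun i _ => ?_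
    rw [Int.fract]
    ring
  rw [hy]
  push_cast
  rw [mul_add, Complex.exp_add]
  have h1 : Complex.exp (2 * Real.pi * Complex.I * (∑ i, (h i : ℂ) * (⌊y i⌋ : ℂ))) = 1 := by
    have : 2 * Real.pi * Complex.I * (∑ i, (h i : ℂ) * (⌊y i⌋ : ℂ)) =
        ((∑ i, h i * ⌊y i⌋ : ℤ) : ℂ) * (2 * Real.pi * Complex.I) := by
      push_cast; ring
    rw [this]
    exact Complex.exp_int_mul_two_pi_mul_I _
  rw [h1, mul_one]

/-- **Weyl's criterion in `ℝ^ι` (⇒), K–N Theorem 6.2.** If `x` is u.d. mod 1 in `ℝ^ι` then for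
every lattice point `h ≠ 0`, `Σ_{n<N} e(⟨h, x n⟩) = o(N)`. [cite: KuipersNiederreiter1974, Ch. 1, Theorem 6.2] -/
theorem EquidistributedModOnePi.isLittleO_weylSumPi (hx : EquidistributedModOnePi x) {h : ι → ℤ}
    (hh : h ≠ 0) :
    (fun N : ℕ => ∑ n ∈ Finset.range N,
        Complex.exp (2 * Real.pi * Complex.I * ((∑ i, (h i : ℝ) * x n i : ℝ) : ℂ))) =o[atTop]
      fun N : ℕ => (N : ℝ) := by
  classical
  -- the character as a function on the cube and its real and imaginary parts
  set χ : (ι → ℝ) → ℂ := fun y =>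
    Complex.exp (2 * Real.pi * Complex.I * ((∑ i, (h i : ℝ) * y i : ℝ) : ℂ)) with hχ
  have hχc : Continuous χ := by rw [hχ]; fun_prop
  -- Riemann sums of `χ` over the `K`-grid vanish for large `K`
  have hRS : ∀ᶠ K : ℕ in atTop, ∑ j ∈ Fintype.piFinset (fun _ : ι => Finset.range K),
      χ (fun i => (j i : ℝ) / K) = 0 := by
    filter_upwards [eventually_gt_atTop (∑ i, (h i).natAbs)] with K hK
    exact sum_piFinset_exp_eq_zero hh hK
  have hre : Tendsto (fun N => fractAvgPi x N fun y => (χ y).re) atTop (𝓝 0) := by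
    refine hx.tendsto_fractAvgPi_of_riemannSum (Complex.continuous_re.comp hχc).continuousOn
      fun ε hε => ?_
    filter_upwards [hRS] with K hK
    simp only [Function.comp_apply]
    rw [← Complex.re_sum, hK]
    simp [hε.le]
  have him : Tendsto (fun N => fractAvgPi x N fun y => (χ y).im) atTop (𝓝 0) := by
    refine hx.tendsto_fractAvgPi_of_riemannSum (Complex.continuous_im.comp hχc).continuousOn
      fun ε hε => ?_
    filter_upwards [hRS] with K hK
    simp only [Function.comp_apply]
    rw [← Complex.im_sum, hK]
    simp [hε.le]
  have hlim : Tendsto (fun N : ℕ => ((fractAvgPi x N fun y => (χ y).re : ℝ) : ℂ) +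
      ((fractAvgPi x N fun y => (χ y).im : ℝ) : ℂ) * Complex.I) atTop
      (𝓝 ((0 : ℝ) + (0 : ℝ) * Complex.I)) :=
    ((Complex.continuous_ofReal.tendsto _).comp hre).add
      (((Complex.continuous_ofReal.tendsto _).comp him).mul_const Complex.I)
  simp only [Complex.ofReal_zero, zero_mul, add_zero] at hlim
  have h1 : (fun N : ℕ => ∑ n ∈ Finset.range N,
      Complex.exp (2 * Real.pi * Complex.I * ((∑ i, (h i : ℝ) * x n i : ℝ) : ℂ))) =o[atTop]
      fun N : ℕ => (N : ℂ) := by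
    refine (Asymptotics.isLittleO_iff_tendsto' ?_).2 ?_
    · filter_upwards [eventually_ne_atTop 0] with N hN hN0
      exact absurd (by exact_mod_cast hN0 : N = 0) hN
    · refine hlim.congr fun N => ?_
      rw [Finset.sum_congr rfl fun n _ => exp_two_pi_mul_sum_eq_fract h (x n)]
      apply Complex.ext
      · simp [fractAvgPi, Complex.re_sum, hχ]
      · simp [fractAvgPi, Complex.im_sum, hχ]
  exact h1.norm_right.congr_right fun N => Complex.norm_natCast N

/-! ### From Weyl's criterion to continuous test functions on the torus -/

/-- The character `e(⟨h, ·⟩)` of the torus evaluated at the class of `y : ℝ^ι` is `e(⟨h, y⟩)`.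
[folklore] -/
theorem mFourier_apply_coe (h : ι → ℤ) (y : ι → ℝ) :
    UnitAddTorus.mFourier h (fun i => ((y i : ℝ) : UnitAddCircle)) =
      Complex.exp (2 * Real.pi * Complex.I * ((∑ i, (h i : ℝ) * y i : ℝ) : ℂ)) := by
  simp only [UnitAddTorus.mFourier, ContinuousMap.coe_mk, fourier_coe_apply]
  rw [← Complex.exp_sum]
  congr 1
  push_cast
  rw [Finset.mul_sum]
  refine Finset.sum_congr rfl fun i _ => ?_
  ring

omit [Fintype ι] in
/-- The averaging functionals `F ↦ (1/N) Σ_{n<N} F(pₙ)` are `1`-Lipschitz on `C(𝕋^ι, ℂ)`.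
[folklore] -/
theorem lipschitzWith_avg_torus (p : ℕ → UnitAddTorus ι) (N : ℕ) :
    LipschitzWith 1 (fun F : C(UnitAddTorus ι, ℂ) => (∑ n ∈ Finset.range N, F (p n)) / (N : ℂ)) := by
  refine LipschitzWith.of_dist_le_mul fun F G => ?_
  rw [NNReal.coe_one, one_mul, dist_eq_norm, dist_eq_norm, ← sub_div, ← Finset.sum_sub_distrib,
    norm_div, Complex.norm_natCast]
  rcases Nat.eq_zero_or_pos N with rfl | hN
  · simp
  · rw [div_le_iff₀ (by exact_mod_cast hN)]
    calc ‖∑ n ∈ Finset.range N, (F (p n) - G (p n))‖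
        ≤ ∑ n ∈ Finset.range N, ‖F (p n) - G (p n)‖ := norm_sum_le _ _
      _ ≤ ∑ _n ∈ Finset.range N, ‖F - G‖ :=
          Finset.sum_le_sum fun n _ => (F - G).norm_coe_le_norm (p n)
      _ = ‖F - G‖ * N := by rw [Finset.sum_const, Finset.card_range, nsmul_eq_mul, mul_comm]

/-- **Weyl's criterion in `ℝ^ι` (⇐, functional form).** If `Σ_{n<N} e(⟨h, x n⟩) = o(N)` for every
lattice point `h ≠ 0`, then for every continuous `F : (ℝ/ℤ)^ι → ℂ`,
`(1/N) Σ_{n<N} F(x n mod 1) → ∫ F dθ` (`dθ` = Haar probability measure on the torus).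
(K–N prove Thm. 6.2 through exactly this density argument.) [cite: KuipersNiederreiter1974, Ch. 1, Theorem 6.2] -/
theorem tendsto_avg_continuousMap_of_weyl
    (hW : ∀ h : ι → ℤ, h ≠ 0 → (fun N : ℕ => ∑ n ∈ Finset.range N,
        Complex.exp (2 * Real.pi * Complex.I * ((∑ i, (h i : ℝ) * x n i : ℝ) : ℂ))) =o[atTop]
      fun N : ℕ => (N : ℝ))
    (F : C(UnitAddTorus ι, ℂ)) :
    Tendsto (fun N : ℕ => (∑ n ∈ Finset.range N, F (fun i => ((x n i : ℝ) : UnitAddCircle))) / (N : ℂ))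
      atTop (𝓝 (∫ z : UnitAddTorus ι, F z)) := by
  set p : ℕ → UnitAddTorus ι := fun n i => ((x n i : ℝ) : UnitAddCircle) with hp
  -- the set of good `F` is closed …
  set S : Set C(UnitAddTorus ι, ℂ) := {F | Tendsto (fun N : ℕ =>
      (∑ n ∈ Finset.range N, F (p n)) / (N : ℂ)) atTop (𝓝 (∫ z : UnitAddTorus ι, F z))} with hS
  have hclosed : IsClosed S := by
    have heq : Equicontinuous (fun (N : ℕ) (F : C(UnitAddTorus ι, ℂ)) =>
        (∑ n ∈ Finset.range N, F (p n)) / (N : ℂ)) :=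
      (LipschitzWith.uniformEquicontinuous _ 1 (lipschitzWith_avg_torus p)).equicontinuous
    exact heq.isClosed_setOf_tendsto KroneckerWeyl.lipschitzWith_integral.continuous
  -- … contains the characters …
  have hchar : ∀ h : ι → ℤ, UnitAddTorus.mFourier h ∈ S := by
    intro h
    simp only [hS, Set.mem_setOf_eq, KroneckerWeyl.integral_mFourier]
    by_cases hh : h = 0
    · subst hh
      simp only [UnitAddTorus.mFourier_zero, ContinuousMap.one_apply, Finset.sum_const,
        Finset.card_range, nsmul_eq_mul, mul_one, if_true]
      refine tendsto_const_nhds.congr' ?_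
      filter_upwards [eventually_ne_atTop 0] with N hN
      rw [div_self (Nat.cast_ne_zero.2 hN)]
    · rw [if_neg hh]
      have h1 : (fun N : ℕ => ∑ n ∈ Finset.range N, UnitAddTorus.mFourier h (p n)) =o[atTop]
          fun N : ℕ => (N : ℂ) := by
        refine ((hW h hh).congr_left fun N => Finset.sum_congr rfl fun n _ => ?_).trans_isBigO ?_
        · rw [hp]
          exact (mFourier_apply_coe h (x n)).symm
        · exact IsBigO.of_bound 1 (Eventually.of_forall fun N => by
            rw [Real.norm_natCast, Complex.norm_natCast, one_mul])
      simpa using h1.tendsto_div_nhds_zero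
  -- … and their span …
  have hspan : (Submodule.span ℂ (Set.range (UnitAddTorus.mFourier (d := ι))) :
      Set C(UnitAddTorus ι, ℂ)) ⊆ S := by
    intro G hG
    induction hG using Submodule.span_induction with
    | mem G hG =>
      obtain ⟨n, rfl⟩ := hG
      exact hchar n
    | zero =>
      simp only [hS, Set.mem_setOf_eq, ContinuousMap.zero_apply, Finset.sum_const_zero, zero_div,
        integral_zero]
      exact tendsto_const_nhds
    | add G₁ G₂ _ _ h₁ h₂ =>
      simp only [hS, Set.mem_setOf_eq, ContinuousMap.add_apply] at h₁ h₂ ⊢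
      rw [integral_add (KroneckerWeyl.integrable_continuousMap G₁)
        (KroneckerWeyl.integrable_continuousMap G₂)]
      simpa only [Finset.sum_add_distrib, add_div] using h₁.add h₂
    | smul c G _ h =>
      simp only [hS, Set.mem_setOf_eq, ContinuousMap.smul_apply, smul_eq_mul] at h ⊢
      rw [integral_const_mul]
      simpa only [← Finset.mul_sum, mul_div_assoc] using h.const_mul c
  -- … which is dense.
  have htop : F ∈ ((Submodule.span ℂ (Set.range (UnitAddTorus.mFourier (d := ι)))).topologicalClosure :
      Set C(UnitAddTorus ι, ℂ)) := by
    rw [UnitAddTorus.span_mFourier_closure_eq_top]; trivial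
  rw [Submodule.topologicalClosure_coe] at htop
  exact hclosed.closure_subset_iff.2 hspan htop

/-- Real-valued test functions: under Weyl's criterion, for continuous `F : (ℝ/ℤ)^ι → ℝ` the
averages `(1/N) Σ_{n<N} F(x n mod 1)` tend to `∫ F dθ`. [cite: KuipersNiederreiter1974, Ch. 1, Theorem 6.2] -/
theorem tendsto_avg_continuousMap_real_of_weyl
    (hW : ∀ h : ι → ℤ, h ≠ 0 → (fun N : ℕ => ∑ n ∈ Finset.range N,
        Complex.exp (2 * Real.pi * Complex.I * ((∑ i, (h i : ℝ) * x n i : ℝ) : ℂ))) =o[atTop]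
      fun N : ℕ => (N : ℝ))
    (F : C(UnitAddTorus ι, ℝ)) :
    Tendsto (fun N : ℕ => (∑ n ∈ Finset.range N, F (fun i => ((x n i : ℝ) : UnitAddCircle))) / (N : ℝ))
      atTop (𝓝 (∫ z : UnitAddTorus ι, F z)) := by
  set Fc : C(UnitAddTorus ι, ℂ) := (⟨Complex.ofReal, Complex.continuous_ofReal⟩ : C(ℝ, ℂ)).comp F
    with hFc
  have h := tendsto_avg_continuousMap_of_weyl hW Fc
  have h2 := (Complex.continuous_re.tendsto _).comp h
  simp only [hFc, ContinuousMap.comp_apply, ContinuousMap.coe_mk, Function.comp_def] at h2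
  convert h2 using 2 with N
  · rw [← Complex.ofReal_sum, ← Complex.ofReal_natCast, ← Complex.ofReal_div, Complex.ofReal_re]
  · rw [integral_complex_ofReal, Complex.ofReal_re]

/-! ### Squeezing boxes between continuous functions on the torus -/

/-- `0 ≤ clamp`, for the clamp `t ↦ max 0 (min 1 t)` to `[0, 1]` (Mathlib's `Set.projIcc 0 1`).
[folklore] -/
theorem clamp01_nonneg (t : ℝ) : 0 ≤ ((Set.projIcc (0 : ℝ) 1 zero_le_one t : Set.Icc (0 : ℝ) 1) : ℝ) :=
  (Set.projIcc 0 1 zero_le_one t).2.1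

/-- `clamp ≤ 1`. [folklore] -/
theorem clamp01_le_one (t : ℝ) : ((Set.projIcc (0 : ℝ) 1 zero_le_one t : Set.Icc (0 : ℝ) 1) : ℝ) ≤ 1 :=
  (Set.projIcc 0 1 zero_le_one t).2.2

/-- `clamp t = 1` for `t ≥ 1`. [folklore] -/
theorem clamp01_of_one_le {t : ℝ} (ht : 1 ≤ t) :
    ((Set.projIcc (0 : ℝ) 1 zero_le_one t : Set.Icc (0 : ℝ) 1) : ℝ) = 1 := by
  rw [Set.projIcc_of_right_le _ ht]

/-- `clamp t = 0` for `t ≤ 0`. [folklore] -/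
theorem clamp01_of_nonpos {t : ℝ} (ht : t ≤ 0) :
    ((Set.projIcc (0 : ℝ) 1 zero_le_one t : Set.Icc (0 : ℝ) 1) : ℝ) = 0 := by
  rw [Set.projIcc_of_le_left _ ht]

/-- `clamp t > 0 ↔ t > 0`. [folklore] -/
theorem clamp01_pos_iff {t : ℝ} :
    0 < ((Set.projIcc (0 : ℝ) 1 zero_le_one t : Set.Icc (0 : ℝ) 1) : ℝ) ↔ 0 < t := by
  rw [Set.coe_projIcc, lt_max_iff, lt_min_iff]
  constructor
  · rintro (h | h)
    · exact absurd h (lt_irrefl 0)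
    · exact h.2
  · intro h; exact Or.inr ⟨one_pos, h⟩

/-- The clamp is continuous. [folklore] -/
theorem continuous_clamp01 :
    Continuous fun t : ℝ => ((Set.projIcc (0 : ℝ) 1 zero_le_one t : Set.Icc (0 : ℝ) 1) : ℝ) :=
  continuous_subtype_val.comp continuous_projIcc

/-- The norm of the class of `t + k` (`k ∈ ℤ`) in `ℝ/ℤ` is that of `t`. [folklore] -/
theorem norm_coe_add_int (t : ℝ) (k : ℤ) :
    ‖((t + k : ℝ) : UnitAddCircle)‖ = ‖((t : ℝ) : UnitAddCircle)‖ := by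
  rw [UnitAddCircle.norm_eq, UnitAddCircle.norm_eq, round_add_intCast]
  push_cast
  ring_nf

/-- `‖t mod 1‖ ≤ |t|`. [folklore] -/
theorem norm_coe_le_abs (t : ℝ) : ‖((t : ℝ) : UnitAddCircle)‖ ≤ |t| := by
  rw [UnitAddCircle.norm_eq]
  simpa using round_le t 0

/-- The class of `{t}` in `ℝ/ℤ` is the class of `t`. [folklore] -/
theorem coe_fract (t : ℝ) : ((Int.fract t : ℝ) : UnitAddCircle) = ((t : ℝ) : UnitAddCircle) := by
  rw [Int.fract, AddCircle.coe_sub]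
  have : (((⌊t⌋ : ℤ) : ℝ) : UnitAddCircle) = 0 := by
    rw [AddCircle.coe_eq_zero_iff]
    exact ⟨⌊t⌋, by simp⟩
  rw [this, sub_zero]

/-- The **upper squeeze function** of the arc `[a, b)`: `z ↦ clamp((r + δ - ‖z - m‖)/δ)`,
`m = (a+b)/2`, `r = (b-a)/2`; continuous on `ℝ/ℤ`, equal to `1` on the arc, vanishing at distance
`≥ r + δ` from `m`. [folklore] -/
def arcUpper (a b δ : ℝ) : C(UnitAddCircle, ℝ) where
  toFun z := ((Set.projIcc (0 : ℝ) 1 zero_le_one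
    (((((b - a) / 2 + δ) - ‖z - (((a + b) / 2 : ℝ) : UnitAddCircle)‖) / δ)) : Set.Icc (0 : ℝ) 1) : ℝ)
  continuous_toFun := continuous_clamp01.comp (by fun_prop)

/-- The **lower squeeze function** of the arc `[a, b)`: `z ↦ clamp((r - ‖z - m‖)/δ)`; continuous,
supported inside the open arc `(a, b)`, equal to `1` at distance `≤ r - δ` from `m`. [folklore] -/
def arcLower (a b δ : ℝ) : C(UnitAddCircle, ℝ) where
  toFun z := ((Set.projIcc (0 : ℝ) 1 zero_le_one
    (((((b - a) / 2) - ‖z - (((a + b) / 2 : ℝ) : UnitAddCircle)‖) / δ)) : Set.Icc (0 : ℝ) 1) : ℝ)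
  continuous_toFun := continuous_clamp01.comp (by fun_prop)

/-- Unfolding lemma for `arcUpper`. [folklore] -/
theorem arcUpper_apply (a b δ : ℝ) (z : UnitAddCircle) : arcUpper a b δ z =
    ((Set.projIcc (0 : ℝ) 1 zero_le_one
      (((((b - a) / 2 + δ) - ‖z - (((a + b) / 2 : ℝ) : UnitAddCircle)‖) / δ)) : Set.Icc (0 : ℝ) 1) : ℝ) :=
  rfl

/-- Unfolding lemma for `arcLower`. [folklore] -/
theorem arcLower_apply (a b δ : ℝ) (z : UnitAddCircle) : arcLower a b δ z =
    ((Set.projIcc (0 : ℝ) 1 zero_le_one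
      (((((b - a) / 2) - ‖z - (((a + b) / 2 : ℝ) : UnitAddCircle)‖) / δ)) : Set.Icc (0 : ℝ) 1) : ℝ) :=
  rfl

/-- Distance on the circle from `y mod 1` to the midpoint of `[a,b)` in terms of `{y}`. [folklore] -/
theorem norm_coe_sub_mid (a b y : ℝ) :
    ‖((y : ℝ) : UnitAddCircle) - (((a + b) / 2 : ℝ) : UnitAddCircle)‖ =
      ‖((Int.fract y - (a + b) / 2 : ℝ) : UnitAddCircle)‖ := by
  rw [← AddCircle.coe_sub, ← norm_coe_add_int (Int.fract y - (a + b) / 2) ⌊y⌋]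
  congr 2
  rw [Int.fract]
  ring

/-- On the arc, the upper squeeze function equals `1`. [folklore] -/
theorem arcUpper_eq_one {a b δ y : ℝ} (hδ : 0 < δ) (hy : Int.fract y ∈ Set.Ico a b) :
    arcUpper a b δ (y : UnitAddCircle) = 1 := by
  rw [arcUpper_apply, norm_coe_sub_mid]
  refine clamp01_of_one_le ?_
  rw [le_div_iff₀ hδ, one_mul]
  have h1 := norm_coe_le_abs (Int.fract y - (a + b) / 2)
  have h2 : |Int.fract y - (a + b) / 2| ≤ (b - a) / 2 := abs_le.2 ⟨by linarith [hy.1], by linarith [hy.2]⟩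
  linarith

/-- The upper squeeze function takes values in `[0, 1]`. [folklore] -/
theorem arcUpper_mem_Icc (a b δ : ℝ) (z : UnitAddCircle) : arcUpper a b δ z ∈ Set.Icc (0 : ℝ) 1 :=
  ⟨clamp01_nonneg _, clamp01_le_one _⟩

/-- The lower squeeze function takes values in `[0, 1]`. [folklore] -/
theorem arcLower_mem_Icc (a b δ : ℝ) (z : UnitAddCircle) : arcLower a b δ z ∈ Set.Icc (0 : ℝ) 1 :=
  ⟨clamp01_nonneg _, clamp01_le_one _⟩

/-- Off the arc (`0 ≤ a`, `b ≤ 1`), the lower squeeze function vanishes. [folklore] -/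
theorem arcLower_eq_zero {a b δ y : ℝ} (ha : 0 ≤ a) (hb : b ≤ 1) (hδ : 0 < δ)
    (hy : Int.fract y ∉ Set.Ico a b) : arcLower a b δ (y : UnitAddCircle) = 0 := by
  by_contra hne
  have hpos : 0 < arcLower a b δ (y : UnitAddCircle) := lt_of_le_of_ne (clamp01_nonneg _) (Ne.symm hne)
  rw [arcLower_apply, clamp01_pos_iff, div_pos_iff_of_pos_right hδ, sub_pos, ← AddCircle.coe_sub,
    UnitAddCircle.norm_eq] at hpos
  -- `|y - m - k| < r` with `k = round (y - m)`, so `⌊y⌋ = k` and `{y} ∈ (a, b)`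
  set k : ℤ := round (y - (a + b) / 2) with hk
  have hlt := abs_lt.1 hpos
  have hfl : ⌊y⌋ = k := by
    rw [Int.floor_eq_iff]
    constructor <;> linarith [hlt.1, hlt.2]
  apply hy
  rw [← Int.self_sub_floor, hfl, Set.mem_Ico]
  constructor <;> linarith [hlt.1, hlt.2]

/-- The integral over `ℝ/ℤ` of a function of the distance to a point: `∫ g(‖z - m‖) dz =
∫_{-1/2}^{1/2} g(|t|) dt`. [folklore] -/
theorem integral_comp_norm_sub (g : ℝ → ℝ) (m : UnitAddCircle) :
    ∫ z : UnitAddCircle, g ‖z - m‖ = ∫ t in (-(1 / 2 : ℝ))..(1 / 2), g |t| := by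
  rw [integral_sub_right_eq_self (fun z : UnitAddCircle => g ‖z‖) m]
  have h := UnitAddCircle.intervalIntegral_preimage (-(1 / 2 : ℝ)) (fun z => g ‖z‖)
  rw [show -(1 / 2 : ℝ) + 1 = 1 / 2 by norm_num] at h
  rw [← h]
  refine intervalIntegral.integral_congr fun t ht => ?_
  rw [Set.uIcc_of_le (by norm_num)] at ht
  rw [(AddCircle.norm_coe_eq_abs_iff (1 : ℝ) one_ne_zero).2]
  rw [abs_one]
  exact abs_le.2 ⟨by linarith [ht.1], by linarith [ht.2]⟩

/-- `∫ arcUpper ≤ (b - a) + 2δ` for `b - a ≤ 1`. [folklore] -/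
theorem integral_arcUpper_le {a b δ : ℝ} (hab : a < b) (hδ : 0 < δ) :
    ∫ z : UnitAddCircle, arcUpper a b δ z ≤ (b - a) + 2 * δ := by
  set c : ℝ := (b - a) / 2 + δ with hc
  have hc0 : 0 < c := by rw [hc]; linarith
  set g : ℝ → ℝ := fun s => ((Set.projIcc (0 : ℝ) 1 zero_le_one ((c - s) / δ) : Set.Icc (0 : ℝ) 1) : ℝ)
    with hg
  have hgc : Continuous g := by rw [hg]; exact continuous_clamp01.comp (by fun_prop)
  have hrw : (fun z : UnitAddCircle => arcUpper a b δ z) =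
      fun z => g ‖z - (((a + b) / 2 : ℝ) : UnitAddCircle)‖ := by
    funext z; rw [arcUpper_apply]
  rw [hrw, integral_comp_norm_sub g]
  have hgabs : Continuous fun t : ℝ => g |t| := hgc.comp continuous_abs
  have hg1 : ∀ t, g |t| ≤ 1 := fun t => clamp01_le_one _
  have hg0 : ∀ t, 0 ≤ g |t| := fun t => clamp01_nonneg _
  have hgz : ∀ t, c ≤ |t| → g |t| = 0 := fun t ht =>
    clamp01_of_nonpos (div_nonpos_of_nonpos_of_nonneg (by linarith) hδ.le)
  rcases le_or_gt c (1 / 2) with hc2 | hc2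
  · -- split `[-1/2, 1/2]` at `±c`
    have hi : ∀ u v : ℝ, IntervalIntegrable (fun t => g |t|) volume u v := fun u v =>
      hgabs.intervalIntegrable u v
    rw [← intervalIntegral.integral_add_adjacent_intervals (hi (-(1/2)) (-c)) (hi (-c) (1/2)),
      ← intervalIntegral.integral_add_adjacent_intervals (hi (-c) c) (hi c (1/2))]
    have h1 : ∫ t in (-(1 / 2 : ℝ))..(-c), g |t| = 0 := by
      rw [← intervalIntegral.integral_zero (a := -(1 / 2 : ℝ)) (b := -c)]
      refine intervalIntegral.integral_congr fun t ht => ?_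
      rw [Set.uIcc_of_le (by linarith)] at ht
      exact hgz t (by rw [abs_of_nonpos (by linarith [ht.2])]; linarith [ht.2])
    have h3 : ∫ t in c..(1 / 2 : ℝ), g |t| = 0 := by
      rw [← intervalIntegral.integral_zero (a := c) (b := (1 / 2 : ℝ))]
      refine intervalIntegral.integral_congr fun t ht => ?_
      rw [Set.uIcc_of_le (by linarith)] at ht
      exact hgz t (by rw [abs_of_nonneg (by linarith [ht.1])]; exact ht.1)
    have h2 : ∫ t in (-c)..c, g |t| ≤ ∫ _ in (-c)..c, (1 : ℝ) :=
      intervalIntegral.integral_mono_on (by linarith) (hi _ _) intervalIntegrable_const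
        fun t _ => hg1 t
    rw [intervalIntegral.integral_const, smul_eq_mul, mul_one] at h2
    rw [h1, h3, zero_add, add_zero, hc] at *
    linarith
  · -- trivial bound by the total mass
    have h2 : ∫ t in (-(1 / 2 : ℝ))..(1 / 2), g |t| ≤ ∫ _ in (-(1 / 2 : ℝ))..(1 / 2), (1 : ℝ) :=
      intervalIntegral.integral_mono_on (by norm_num) (hgabs.intervalIntegrable _ _)
        intervalIntegrable_const fun t _ => hg1 t
    rw [intervalIntegral.integral_const, smul_eq_mul, mul_one] at h2
    rw [hc] at hc2
    linarith

/-- `(b - a) - 2δ ≤ ∫ arcLower` for `b - a ≤ 1`. [folklore] -/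
theorem le_integral_arcLower {a b δ : ℝ} (hab1 : b - a ≤ 1) (hδ : 0 < δ) :
    (b - a) - 2 * δ ≤ ∫ z : UnitAddCircle, arcLower a b δ z := by
  set r : ℝ := (b - a) / 2 with hr
  set g : ℝ → ℝ := fun s => ((Set.projIcc (0 : ℝ) 1 zero_le_one ((r - s) / δ) : Set.Icc (0 : ℝ) 1) : ℝ)
    with hg
  have hgc : Continuous g := by rw [hg]; exact continuous_clamp01.comp (by fun_prop)
  have hrw : (fun z : UnitAddCircle => arcLower a b δ z) =
      fun z => g ‖z - (((a + b) / 2 : ℝ) : UnitAddCircle)‖ := by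
    funext z; rw [arcLower_apply]
  rw [hrw, integral_comp_norm_sub g]
  have hgabs : Continuous fun t : ℝ => g |t| := hgc.comp continuous_abs
  have hg0 : ∀ t, 0 ≤ g |t| := fun t => clamp01_nonneg _
  have hi : ∀ u v : ℝ, IntervalIntegrable (fun t => g |t|) volume u v := fun u v =>
    hgabs.intervalIntegrable u v
  rcases le_or_gt r δ with hrδ | hrδ
  · have : 0 ≤ ∫ t in (-(1 / 2 : ℝ))..(1 / 2), g |t| :=
      intervalIntegral.integral_nonneg (by norm_num) fun t _ => hg0 t
    rw [hr] at hrδ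
    linarith
  · set c : ℝ := r - δ with hc
    have hc0 : 0 < c := by rw [hc]; linarith
    have hc2 : c ≤ 1 / 2 := by rw [hc, hr]; linarith
    have hg1 : ∀ t, |t| ≤ c → g |t| = 1 := fun t ht =>
      clamp01_of_one_le (by rw [le_div_iff₀ hδ, one_mul]; linarith)
    rw [← intervalIntegral.integral_add_adjacent_intervals (hi (-(1/2)) (-c)) (hi (-c) (1/2)),
      ← intervalIntegral.integral_add_adjacent_intervals (hi (-c) c) (hi c (1/2))]
    have h1 : 0 ≤ ∫ t in (-(1 / 2 : ℝ))..(-c), g |t| :=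
      intervalIntegral.integral_nonneg (by linarith) fun t _ => hg0 t
    have h3 : 0 ≤ ∫ t in c..(1 / 2 : ℝ), g |t| :=
      intervalIntegral.integral_nonneg (by linarith) fun t _ => hg0 t
    have h2 : ∫ t in (-c)..c, g |t| = ∫ _ in (-c)..c, (1 : ℝ) := by
      refine intervalIntegral.integral_congr fun t ht => ?_
      rw [Set.uIcc_of_le (by linarith)] at ht
      exact hg1 t (abs_le.2 ⟨ht.1, ht.2⟩)
    rw [intervalIntegral.integral_const, smul_eq_mul, mul_one] at h2
    rw [h2, hc, hr]
    linarith

/-- The **box squeeze functions**: products over the coordinates of the arc squeeze functions;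
continuous on the torus. [folklore] -/
def boxUpper (a b : ι → ℝ) (δ : ℝ) : C(UnitAddTorus ι, ℝ) where
  toFun z := ∏ i, arcUpper (a i) (b i) δ (z i)
  continuous_toFun := continuous_finsetProd _ fun i _ =>
    (arcUpper (a i) (b i) δ).continuous.comp (continuous_apply i)

/-- The lower box squeeze function. [folklore] -/
def boxLower (a b : ι → ℝ) (δ : ℝ) : C(UnitAddTorus ι, ℝ) where
  toFun z := ∏ i, arcLower (a i) (b i) δ (z i)
  continuous_toFun := continuous_finsetProd _ fun i _ =>
    (arcLower (a i) (b i) δ).continuous.comp (continuous_apply i)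

/-- Unfolding lemma for `boxUpper`. [folklore] -/
theorem boxUpper_apply (a b : ι → ℝ) (δ : ℝ) (z : UnitAddTorus ι) :
    boxUpper a b δ z = ∏ i, arcUpper (a i) (b i) δ (z i) := rfl

/-- Unfolding lemma for `boxLower`. [folklore] -/
theorem boxLower_apply (a b : ι → ℝ) (δ : ℝ) (z : UnitAddTorus ι) :
    boxLower a b δ z = ∏ i, arcLower (a i) (b i) δ (z i) := rfl

/-- The indicator of the box is below the upper squeeze function. [folklore] -/
theorem indicator_le_boxUpper {a b : ι → ℝ} {δ : ℝ} (hδ : 0 < δ) (y : ι → ℝ) :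
    Set.indicator (Set.pi Set.univ fun i => Set.Ico (a i) (b i)) (1 : (ι → ℝ) → ℝ)
        (fun i => Int.fract (y i)) ≤
      boxUpper a b δ (fun i => ((y i : ℝ) : UnitAddCircle)) := by
  by_cases h : (fun i => Int.fract (y i)) ∈ Set.pi Set.univ fun i => Set.Ico (a i) (b i)
  · rw [Set.indicator_of_mem h, Pi.one_apply, boxUpper_apply]
    refine le_of_eq (Finset.prod_eq_one fun i _ => ?_).symm
    exact arcUpper_eq_one hδ (h i (Set.mem_univ i))
  · rw [Set.indicator_of_notMem h, boxUpper_apply]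
    exact Finset.prod_nonneg fun i _ => (arcUpper_mem_Icc _ _ _ _).1

/-- The lower squeeze function is below the indicator of the box (`0 ≤ a_i`, `b_i ≤ 1`). [folklore] -/
theorem boxLower_le_indicator {a b : ι → ℝ} {δ : ℝ} (ha : ∀ i, 0 ≤ a i) (hb : ∀ i, b i ≤ 1)
    (hδ : 0 < δ) (y : ι → ℝ) :
    boxLower a b δ (fun i => ((y i : ℝ) : UnitAddCircle)) ≤
      Set.indicator (Set.pi Set.univ fun i => Set.Ico (a i) (b i)) (1 : (ι → ℝ) → ℝ)
        (fun i => Int.fract (y i)) := by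
  by_cases h : (fun i => Int.fract (y i)) ∈ Set.pi Set.univ fun i => Set.Ico (a i) (b i)
  · rw [Set.indicator_of_mem h, Pi.one_apply, boxLower_apply]
    exact Finset.prod_le_one (fun i _ => (arcLower_mem_Icc _ _ _ _).1)
      fun i _ => (arcLower_mem_Icc _ _ _ _).2
  · rw [Set.indicator_of_notMem h, boxLower_apply]
    simp only [Set.mem_pi, Set.mem_univ, true_imp_iff, not_forall] at h
    obtain ⟨i, hi⟩ := h
    exact le_of_eq (Finset.prod_eq_zero (Finset.mem_univ i) (arcLower_eq_zero (ha i) (hb i) hδ hi))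

/-- `∫ boxUpper dθ ≤ Π_i ((b_i - a_i) + 2δ)`. [folklore] -/
theorem integral_boxUpper_le {a b : ι → ℝ} {δ : ℝ} (hab : ∀ i, a i < b i) (hδ : 0 < δ) :
    ∫ z : UnitAddTorus ι, boxUpper a b δ z ≤ ∏ i, ((b i - a i) + 2 * δ) := by
  simp only [boxUpper_apply]
  rw [integral_fintype_prod_volume_eq_prod (fun i (z : UnitAddCircle) => arcUpper (a i) (b i) δ z)]
  refine Finset.prod_le_prod (fun i _ => integral_nonneg fun z => (arcUpper_mem_Icc _ _ _ z).1)
    fun i _ => integral_arcUpper_le (hab i) hδ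

/-- `Π_i ((b_i - a_i) - 2δ)⁺ ≤ ∫ boxLower dθ`. [folklore] -/
theorem le_integral_boxLower {a b : ι → ℝ} {δ : ℝ} (hab1 : ∀ i, b i - a i ≤ 1) (hδ : 0 < δ) :
    ∏ i, max 0 ((b i - a i) - 2 * δ) ≤ ∫ z : UnitAddTorus ι, boxLower a b δ z := by
  simp only [boxLower_apply]
  rw [integral_fintype_prod_volume_eq_prod (fun i (z : UnitAddCircle) => arcLower (a i) (b i) δ z)]
  refine Finset.prod_le_prod (fun i _ => le_max_left _ _) fun i _ => max_le ?_ ?_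
  · exact integral_nonneg fun z => (arcLower_mem_Icc _ _ _ z).1
  · exact le_integral_arcLower (hab1 i) hδ

/-- **Weyl's criterion in `ℝ^ι` (⇐), K–N Theorem 6.2.** If `Σ_{n<N} e(⟨h, x n⟩) = o(N)` for every
lattice point `h ≠ 0`, then `x` is u.d. mod 1 in `ℝ^ι`. [cite: KuipersNiederreiter1974, Ch. 1, Theorem 6.2] -/
theorem equidistributedModOnePi_of_isLittleO_weylSumPi
    (hW : ∀ h : ι → ℤ, h ≠ 0 → (fun N : ℕ => ∑ n ∈ Finset.range N,
        Complex.exp (2 * Real.pi * Complex.I * ((∑ i, (h i : ℝ) * x n i : ℝ) : ℂ))) =o[atTop]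
      fun N : ℕ => (N : ℝ)) :
    EquidistributedModOnePi x := by
  intro a b ha hab hb
  have hab1 : ∀ i, b i - a i ≤ 1 := fun i => by linarith [ha i, hb i]
  -- the averages of the squeeze functions converge to their integrals
  have hU : ∀ δ : ℝ, Tendsto (fun N : ℕ => (∑ n ∈ Finset.range N,
      boxUpper a b δ (fun i => ((x n i : ℝ) : UnitAddCircle))) / (N : ℝ)) atTop
      (𝓝 (∫ z : UnitAddTorus ι, boxUpper a b δ z)) := fun δ =>
    tendsto_avg_continuousMap_real_of_weyl hW _
  have hL : ∀ δ : ℝ, Tendsto (fun N : ℕ => (∑ n ∈ Finset.range N,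
      boxLower a b δ (fun i => ((x n i : ℝ) : UnitAddCircle))) / (N : ℝ)) atTop
      (𝓝 (∫ z : UnitAddTorus ι, boxLower a b δ z)) := fun δ =>
    tendsto_avg_continuousMap_real_of_weyl hW _
  -- the bounds `Π((b-a) ± 2δ)` tend to `Π(b - a)` as `δ → 0`
  have hPU : Tendsto (fun δ : ℝ => ∏ i, ((b i - a i) + 2 * δ)) (𝓝 0) (𝓝 (∏ i, (b i - a i))) := by
    have : Continuous fun δ : ℝ => ∏ i, ((b i - a i) + 2 * δ) := by fun_prop
    simpa using this.tendsto 0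
  have hPL : Tendsto (fun δ : ℝ => ∏ i, max 0 ((b i - a i) - 2 * δ)) (𝓝 0) (𝓝 (∏ i, (b i - a i))) := by
    have hc : Continuous fun δ : ℝ => ∏ i, max 0 ((b i - a i) - 2 * δ) := by fun_prop
    have := hc.tendsto 0
    simp only [mul_zero, sub_zero] at this
    convert this using 2
    exact Finset.prod_congr rfl fun i _ => (max_eq_right (by linarith [hab i])).symm
  -- squeeze, written with `fractAvgPi` of the indicator of the box
  have hcount : ∀ N, (fractCountPi x a b N : ℝ) / N =
      fractAvgPi x N (Set.indicator (Set.pi Set.univ fun i => Set.Ico (a i) (b i)) 1) :=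
    fun N => (fractAvgPi_indicator x N a b).symm
  simp_rw [hcount]
  refine tendsto_fractAvgPi_squeeze x fun ε hε => ?_
  -- choose `δ > 0` with both bounds within `ε` of the volume
  have hε' : ∀ᶠ δ : ℝ in 𝓝 0, ∏ i, ((b i - a i) + 2 * δ) < (∏ i, (b i - a i)) + ε ∧
      (∏ i, (b i - a i)) - ε < ∏ i, max 0 ((b i - a i) - 2 * δ) :=
    ((tendsto_order.1 hPU).2 _ (by linarith)).and ((tendsto_order.1 hPL).1 _ (by linarith))
  obtain ⟨δ, hδmem, hδU, hδL⟩ : ∃ δ : ℝ, δ ∈ Set.Ioo (0 : ℝ) 1 ∧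
      ∏ i, ((b i - a i) + 2 * δ) < (∏ i, (b i - a i)) + ε ∧
      (∏ i, (b i - a i)) - ε < ∏ i, max 0 ((b i - a i) - 2 * δ) := by
    have h1 : ∀ᶠ δ : ℝ in 𝓝[>] 0, δ ∈ Set.Ioo (0 : ℝ) 1 := Ioo_mem_nhdsGT one_pos
    obtain ⟨δ, h⟩ := (h1.and (nhdsWithin_le_nhds hε')).exists
    exact ⟨δ, h.1, h.2⟩
  have hδ : 0 < δ := hδmem.1
  refine ⟨fun y => boxLower a b δ (fun i => ((y i : ℝ) : UnitAddCircle)),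
    fun y => boxUpper a b δ (fun i => ((y i : ℝ) : UnitAddCircle)),
    ∫ z : UnitAddTorus ι, boxLower a b δ z, ∫ z : UnitAddTorus ι, boxUpper a b δ z,
    fun y hy => ?_, fun y hy => ?_, ?_, ?_, ?_, ?_⟩
  · have hfy : (fun i => Int.fract (y i)) = y :=
      funext fun i => Int.fract_eq_self.2 ⟨(hy i (Set.mem_univ i)).1, (hy i (Set.mem_univ i)).2⟩
    simpa only [hfy] using boxLower_le_indicator ha hb hδ y
  · have hfy : (fun i => Int.fract (y i)) = y :=
      funext fun i => Int.fract_eq_self.2 ⟨(hy i (Set.mem_univ i)).1, (hy i (Set.mem_univ i)).2⟩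
    simpa only [hfy] using indicator_le_boxUpper hδ y
  · refine (hL δ).congr fun N => ?_
    simp only [fractAvgPi, coe_fract]
  · refine (hU δ).congr fun N => ?_
    simp only [fractAvgPi, coe_fract]
  · linarith [le_integral_boxLower hab1 hδ (ι := ι)]
  · linarith [integral_boxUpper_le hab hδ (ι := ι)]

/-- **Weyl's criterion in `ℝ^ι`, K–N Theorem 6.2.** A sequence `x` of vectors is u.d. mod 1 in
`ℝ^ι` if and only if `Σ_{n<N} e(⟨h, x n⟩) = o(N)` for every lattice point `h ≠ 0`.
[cite: KuipersNiederreiter1974, Ch. 1, Theorem 6.2] -/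
theorem equidistributedModOnePi_iff_weyl (x : ℕ → ι → ℝ) :
    EquidistributedModOnePi x ↔ ∀ h : ι → ℤ, h ≠ 0 → (fun N : ℕ => ∑ n ∈ Finset.range N,
        Complex.exp (2 * Real.pi * Complex.I * ((∑ i, (h i : ℝ) * x n i : ℝ) : ℂ))) =o[atTop]
      fun N : ℕ => (N : ℝ) :=
  ⟨fun hx _ hh => hx.isLittleO_weylSumPi hh, equidistributedModOnePi_of_isLittleO_weylSumPi⟩

/-- Weyl's criterion phrased with `weylSumPi`. [cite: KuipersNiederreiter1974, Ch. 1, Theorem 6.2] -/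
theorem equidistributedModOnePi_iff_isLittleO_weylSumPi (x : ℕ → ι → ℝ) :
    EquidistributedModOnePi x ↔ ∀ h : ι → ℤ, h ≠ 0 → (weylSumPi x h) =o[atTop] fun N : ℕ => (N : ℝ) :=
  equidistributedModOnePi_iff_weyl x

/-- **K–N Theorem 6.1, periodic form.** If `x` is u.d. mod 1 in `ℝ^ι` then for every continuous
`F : (ℝ/ℤ)^ι → ℂ`, `(1/N) Σ_{n<N} F(x n mod 1) → ∫ F dθ`. (K–N state Thm. 6.1 for continuous `f`
on the closed cube; a continuous `F` on the torus is the case of `f` `1`-periodic in each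
variable, for which `f({x n}) = f(x n)`.) [cite: KuipersNiederreiter1974, Ch. 1, Theorem 6.1] -/
theorem EquidistributedModOnePi.tendsto_avg_continuousMap (hx : EquidistributedModOnePi x)
    (F : C(UnitAddTorus ι, ℂ)) :
    Tendsto (fun N : ℕ => (∑ n ∈ Finset.range N, F (fun i => ((x n i : ℝ) : UnitAddCircle))) / (N : ℂ))
      atTop (𝓝 (∫ z : UnitAddTorus ι, F z)) :=
  tendsto_avg_continuousMap_of_weyl (fun _ hh => hx.isLittleO_weylSumPi hh) F

/-- Real-valued continuous test functions on the torus, written with `fractAvgPi`: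
`(1/N) Σ_{n<N} F({x n} mod 1) → ∫ F dθ`. [cite: KuipersNiederreiter1974, Ch. 1, Theorem 6.1] -/
theorem EquidistributedModOnePi.tendsto_fractAvgPi_continuousMap (hx : EquidistributedModOnePi x)
    (F : C(UnitAddTorus ι, ℝ)) :
    Tendsto (fun N : ℕ => fractAvgPi x N fun y => F (fun i => ((y i : ℝ) : UnitAddCircle)))
      atTop (𝓝 (∫ z : UnitAddTorus ι, F z)) := by
  refine (tendsto_avg_continuousMap_real_of_weyl (fun _ hh => hx.isLittleO_weylSumPi hh) F).congr
    fun N => ?_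
  simp only [fractAvgPi, coe_fract]

/-- **K–N Corollary 1.1 in `ℝ^ι`, sandwich form (Riemann-integrable test functions).** If `x` is
u.d. mod 1 in `ℝ^ι` and the real test function `f` on `[0,1)^ι` can, for every `ε > 0`, be squeezed
between `G₁(y mod 1) ≤ f y ≤ G₂(y mod 1)` with `G₁, G₂` continuous on the torus and
`L - ε ≤ ∫ G₁`, `∫ G₂ ≤ L + ε`, then `(1/N) Σ_{n<N} f({x n}) → L`.
[cite: KuipersNiederreiter1974, Ch. 1, Theorem 6.1] -/
theorem EquidistributedModOnePi.tendsto_fractAvgPi_of_sandwich (hx : EquidistributedModOnePi x)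
    {f : (ι → ℝ) → ℝ} {L : ℝ}
    (h : ∀ ε > 0, ∃ G₁ G₂ : C(UnitAddTorus ι, ℝ),
      (∀ y ∈ Set.pi Set.univ fun _ : ι => Set.Ico (0 : ℝ) 1,
        G₁ (fun i => ((y i : ℝ) : UnitAddCircle)) ≤ f y) ∧
      (∀ y ∈ Set.pi Set.univ fun _ : ι => Set.Ico (0 : ℝ) 1,
        f y ≤ G₂ (fun i => ((y i : ℝ) : UnitAddCircle))) ∧
      L - ε ≤ ∫ z : UnitAddTorus ι, G₁ z ∧ ∫ z : UnitAddTorus ι, G₂ z ≤ L + ε) :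
    Tendsto (fun N => fractAvgPi x N f) atTop (𝓝 L) := by
  refine tendsto_fractAvgPi_squeeze x fun ε hε => ?_
  obtain ⟨G₁, G₂, h₁, h₂, hL₁, hL₂⟩ := h ε hε
  exact ⟨_, _, _, _, h₁, h₂, hx.tendsto_fractAvgPi_continuousMap G₁,
    hx.tendsto_fractAvgPi_continuousMap G₂, hL₁, hL₂⟩

end Literature.NumberTheory.UniformDistribution

end
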